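import Summits.QuantumAdvantage.QuantumAdvantage.Theorems.RingSparseActiveHalfCube

/-!
# Sparse-active strategies lose the ring game — part 2: the double-comb pattern

The pattern `pat N m p w = 1^p · comb(u) · comb(a) · 1⋯1 · 0` on the `N`-cycle (window at offset `p`, parameters
`w = (u, a) ∈ {0,1}^m × {0,1}^m`): every bit a constant or a positive literal (`pat_literal`), odd class (`oddZeros_pat`),
walk coordinates left / right of the window (`Wk_pat_left`, `Wk_pat_right`), the three-block residue law
`W_pat_mod : W ≡ bx u + bx a (mod 3)`, and the canonical guess away from the window (`tGuess_pat`).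
-/

set_option linter.dupNamespace false -- D-0017: single-problem summit ⇒ QuantumAdvantage.QuantumAdvantage by design

namespace Summit.QuantumAdvantage.QuantumAdvantage.Theorems.RingSparseActive

open Finset Module Literature.Computability.MetaComplexity Literature.Computability.MetaComplexity.Smolensky

section Comb

open Summit.QuantumAdvantage.AdviceFreeQNC0 Literature.Computability.QuantumComplexity
  Literature.Computability.QuantumComplexity.RingHLF

variable {N m p : ℕ}

/-- First block of the parameters. -/
def uPart (m : ℕ) (w : Fin (m + m) → Bool) : Fin m → Bool := fun j => w (Fin.castAdd m j)
/-- Second block of the parameters. -/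
def aPart (m : ℕ) (w : Fin (m + m) → Bool) : Fin m → Bool := fun j => w (Fin.natAdd m j)

/-- **The double-comb pattern** `1^p · comb(u) · comb(a) · 1 ⋯ 1 · 0` of length `N`. -/
def pat (N m p : ℕ) (w : Fin (m + m) → Bool) : Fin N → Bool := fun i =>
  if i.val < p then true
  else if i.val < p + (6 * m + 1) then combBit m (ext (uPart m w)) (i.val - p)
  else if i.val < p + (6 * m + 1) + (6 * m + 1) then combBit m (ext (aPart m w)) (i.val - (p + (6 * m + 1)))
  else if i.val = N - 1 then false else true

/-- `pat` left of the window is `true`. -/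
theorem pat_of_lt (w : Fin (m + m) → Bool) {k : ℕ} (hk : k < N) (h : k < p) : pat N m p w ⟨k, hk⟩ = true := by
  simp [pat, h]

/-- `pat` on the first comb block. -/
theorem pat_comb1 (w : Fin (m + m) → Bool) {r : ℕ} (hr : r < 6 * m + 1) (hk : p + r < N) :
    pat N m p w ⟨p + r, hk⟩ = combBit m (ext (uPart m w)) r := by
  simp only [pat, show ¬ p + r < p by omega, show p + r < p + (6 * m + 1) by omega, if_false, if_true]
  rw [Nat.add_sub_cancel_left]

/-- `pat` on the second comb block. -/
theorem pat_comb2 (w : Fin (m + m) → Bool) {r : ℕ} (hr : r < 6 * m + 1) (hk : p + (6 * m + 1) + r < N) :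
    pat N m p w ⟨p + (6 * m + 1) + r, hk⟩ = combBit m (ext (aPart m w)) r := by
  simp only [pat, show ¬ p + (6 * m + 1) + r < p by omega, show ¬ p + (6 * m + 1) + r < p + (6 * m + 1) by omega,
    show p + (6 * m + 1) + r < p + (6 * m + 1) + (6 * m + 1) by omega, if_false, if_true]
  rw [Nat.add_sub_cancel_left]

/-- `pat` right of the window (before the last position) is `true`. -/
theorem pat_after (w : Fin (m + m) → Bool) {k : ℕ} (hk : k < N) (h : p + (6 * m + 1) + (6 * m + 1) ≤ k)
    (hne : k ≠ N - 1) : pat N m p w ⟨k, hk⟩ = true := by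
  simp only [pat, show ¬ k < p by omega, show ¬ k < p + (6 * m + 1) by omega,
    show ¬ k < p + (6 * m + 1) + (6 * m + 1) by omega, hne, if_false]

/-- `pat` at the last position is `false`. -/
theorem pat_last (w : Fin (m + m) → Bool) (hN : p + (6 * m + 1) + (6 * m + 1) + 1 ≤ N) :
    pat N m p w ⟨N - 1, by omega⟩ = false := by
  simp only [pat, show ¬ N - 1 < p by omega, show ¬ N - 1 < p + (6 * m + 1) by omega,
    show ¬ N - 1 < p + (6 * m + 1) + (6 * m + 1) by omega, if_false, if_true]

/-- `pat` at a position equal to the last one is `false`. -/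
theorem pat_eq_last (w : Fin (m + m) → Bool) (hN : p + (6 * m + 1) + (6 * m + 1) + 1 ≤ N) {k : ℕ} (hk : k < N)
    (h : k = N - 1) : pat N m p w ⟨k, hk⟩ = false := by
  subst h; exact pat_last w hN

/-- Zero-parity before the window: `0`. -/
theorem zpar_pat_le (w : Fin (m + m) → Bool) (hN : p ≤ N) : ∀ {k : ℕ}, k ≤ p → zpar (pat N m p w) k = false
  | 0, _ => zpar_zero _
  | k + 1, h => by
    rw [zpar_succ _ (show k < N by omega), zpar_pat_le w hN (Nat.le_of_succ_le h),
      pat_of_lt w (by omega) (by omega)]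
    rfl

/-- Zero-parity inside the first comb. -/
theorem zpar_pat_comb1 (w : Fin (m + m) → Bool) (hN : p + (6 * m + 1) ≤ N) :
    ∀ {r : ℕ}, r < 6 * m + 1 → zpar (pat N m p w) (p + r + 1) = combPar m (ext (uPart m w)) r
  | 0, _ => by
    rw [zpar_succ _ (show p + 0 < N by omega), zpar_pat_le w (by omega) (by omega), pat_comb1 w (by omega),
      combPar_zero, Bool.false_xor]
  | r + 1, h => by
    rw [show p + (r + 1) + 1 = (p + r + 1) + 1 by ring, zpar_succ _ (show p + r + 1 < N by omega),
      zpar_pat_comb1 w hN (show r < 6 * m + 1 by omega), combPar_succ]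
    congr 2
    exact pat_comb1 w h (by omega)

/-- Zero-parity inside the second comb (`m ≥ 1`). -/
theorem zpar_pat_comb2 (hm : 1 ≤ m) (w : Fin (m + m) → Bool) (hN : p + (6 * m + 1) + (6 * m + 1) ≤ N) :
    ∀ {r : ℕ}, r < 6 * m + 1 →
      zpar (pat N m p w) (p + (6 * m + 1) + r + 1) = combPar m (ext (aPart m w)) r
  | 0, _ => by
    have h0 := zpar_pat_comb1 (N := N) (p := p) w (by omega) (show 6 * m < 6 * m + 1 by omega)
    rw [combPar_end hm] at h0
    have h0' : zpar (pat N m p w) (p + (6 * m + 1) + 0) = false := by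
      rw [show p + (6 * m + 1) + 0 = p + 6 * m + 1 by ring]; exact h0
    rw [zpar_succ _ (show p + (6 * m + 1) + 0 < N by omega), h0', pat_comb2 w (by omega) (by omega),
      combPar_zero, Bool.false_xor]
  | r + 1, h => by
    rw [show p + (6 * m + 1) + (r + 1) + 1 = (p + (6 * m + 1) + r + 1) + 1 by ring,
      zpar_succ _ (show p + (6 * m + 1) + r + 1 < N by omega),
      zpar_pat_comb2 hm w hN (show r < 6 * m + 1 by omega), combPar_succ]
    congr 2
    exact pat_comb2 w h (by omega)

/-- Zero-parity after the window and before the last bit: `0`. -/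
theorem zpar_pat_after (hm : 1 ≤ m) (w : Fin (m + m) → Bool) (hN : p + (6 * m + 1) + (6 * m + 1) + 1 ≤ N) :
    ∀ {j : ℕ}, p + (6 * m + 1) + (6 * m + 1) + j ≤ N - 1 →
      zpar (pat N m p w) (p + (6 * m + 1) + (6 * m + 1) + j) = false
  | 0, _ => by
    have h0 := zpar_pat_comb2 (N := N) (p := p) hm w (by omega) (show 6 * m < 6 * m + 1 by omega)
    rw [combPar_end hm] at h0
    rw [show p + (6 * m + 1) + (6 * m + 1) + 0 = p + (6 * m + 1) + 6 * m + 1 by ring, h0]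
  | j + 1, h => by
    rw [show p + (6 * m + 1) + (6 * m + 1) + (j + 1) = (p + (6 * m + 1) + (6 * m + 1) + j) + 1 by ring,
      zpar_succ _ (show p + (6 * m + 1) + (6 * m + 1) + j < N by omega),
      zpar_pat_after hm w hN (show p + (6 * m + 1) + (6 * m + 1) + j ≤ N - 1 by omega),
      pat_after w (by omega) (by omega) (by omega)]
    rfl

/-- The pattern has an odd number of zeros. -/
theorem oddZeros_pat (hm : 1 ≤ m) (w : Fin (m + m) → Bool) (hN : p + (6 * m + 1) + (6 * m + 1) + 1 ≤ N) :
    OddZeros (pat N m p w) := by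
  have hlast : zpar (pat N m p w) (N - 1) = false := by
    have := zpar_pat_after (N := N) hm w hN (j := N - 1 - (p + (6 * m + 1) + (6 * m + 1))) (by omega)
    rwa [show p + (6 * m + 1) + (6 * m + 1) + (N - 1 - (p + (6 * m + 1) + (6 * m + 1))) = N - 1 by omega] at this
  have hN' : zpar (pat N m p w) (N - 1 + 1) = true := by
    rw [zpar_succ _ (show N - 1 < N by omega), hlast, pat_last w hN]; rfl
  rw [show N - 1 + 1 = N by omega] at hN'
  unfold zpar at hN'
  unfold OddZeros
  have hset : (univ.filter fun j : Fin N => j.val < N ∧ pat N m p w j = false) =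
      univ.filter fun j : Fin N => pat N m p w j = false := by
    ext j; simp
  rw [hset] at hN'
  simpa using hN'

/-- `W_k` as a sum of prefix parities. -/
theorem Wk_eq_sum (x : Fin N → Bool) : ∀ {k : ℕ}, k ≤ N →
    Wk x k = ∑ i ∈ range k, (if zpar x (i + 1) = true then 1 else 0)
  | 0, _ => by rw [Wk_zero, sum_range_zero]
  | k + 1, h => by
    rw [Wk_succ x (show k < N by omega), Wk_eq_sum x (Nat.le_of_succ_le h), sum_range_succ,
      uCoord_eq_zpar]

/-- `W_k = 0` left of the window. -/
theorem Wk_pat_left (w : Fin (m + m) → Bool) (hN : p ≤ N) {k : ℕ} (hk : k ≤ p) : Wk (pat N m p w) k = 0 := by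
  rw [Wk_eq_sum _ (by omega)]
  refine sum_eq_zero fun i hi => ?_
  rw [mem_range] at hi
  rw [zpar_pat_le w hN (show i + 1 ≤ p by omega)]
  rfl

/-- `W_k` right of the window (and `W = W_{N-1}` itself) is the sum of the two comb sums. -/
theorem Wk_pat_right (hm : 1 ≤ m) (w : Fin (m + m) → Bool) (hN : p + (6 * m + 1) + (6 * m + 1) + 1 ≤ N)
    {k : ℕ} (hk1 : p + (6 * m + 1) + (6 * m + 1) ≤ k) (hk2 : k ≤ N - 1) :
    Wk (pat N m p w) k = combSum m (ext (uPart m w)) + combSum m (ext (aPart m w)) := by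
  rw [Wk_eq_sum _ (by omega)]
  obtain ⟨j, rfl⟩ := Nat.exists_eq_add_of_le hk1
  rw [sum_range_add, sum_range_add, sum_range_add]
  have h0 : ∑ i ∈ range p, (if zpar (pat N m p w) (i + 1) = true then 1 else 0) = 0 := by
    refine sum_eq_zero fun i hi => ?_
    rw [mem_range] at hi
    rw [zpar_pat_le w (by omega) (show i + 1 ≤ p by omega)]; rfl
  have h1 : ∑ r ∈ range (6 * m + 1), (if zpar (pat N m p w) (p + r + 1) = true then 1 else 0) =
      combSum m (ext (uPart m w)) := by
    refine sum_congr rfl fun r hr => ?_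
    rw [mem_range] at hr
    rw [zpar_pat_comb1 w (by omega) hr]
  have h2 : ∑ r ∈ range (6 * m + 1), (if zpar (pat N m p w) (p + (6 * m + 1) + r + 1) = true then 1 else 0) =
      combSum m (ext (aPart m w)) := by
    refine sum_congr rfl fun r hr => ?_
    rw [mem_range] at hr
    rw [zpar_pat_comb2 hm w (by omega) hr]
  have h3 : ∑ i ∈ range j, (if zpar (pat N m p w) (p + (6 * m + 1) + (6 * m + 1) + i + 1) = true then 1 else 0) = 0 := by
    refine sum_eq_zero fun i hi => ?_
    rw [mem_range] at hi
    rw [show p + (6 * m + 1) + (6 * m + 1) + i + 1 = p + (6 * m + 1) + (6 * m + 1) + (i + 1) by ring,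
      zpar_pat_after hm w hN (by omega)]; rfl
  rw [h0, h1, h2, h3]; ring

/-- **Residue law of the double comb**: `W ≡ bx u + bx a (mod 3)`. -/
theorem W_pat_mod (hm : 1 ≤ m) (w : Fin (m + m) → Bool) (hN : p + (6 * m + 1) + (6 * m + 1) + 1 ≤ N) :
    Wk (pat N m p w) (N - 1) % 3 = (bx (uPart m w) + bx (aPart m w)) % 3 := by
  rw [Wk_pat_right hm w hN (by omega) le_rfl, Nat.add_mod, combSum_mod_three, combSum_mod_three]
  rfl

/-- The canonical guess at positions away from the window is constant in the parameters. -/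
theorem tGuess_pat (w : Fin (m + m) → Bool) (hp : 1 ≤ p) (hN : p + (6 * m + 1) + (6 * m + 1) + 1 ≤ N) (k : Fin N)
    (hk : k.val + 2 ≤ p ∨ p + (6 * m + 1) + (6 * m + 1) + 1 ≤ k.val) :
    tGuess (pat N m p w) k = decide (N - 2 ≤ k.val) := by
  obtain ⟨k, hkN⟩ := k
  simp only at hk ⊢
  unfold tGuess nxt
  rcases hk with hk | hk
  · have e : (k + 1) % N = k + 1 := Nat.mod_eq_of_lt (by omega)
    simp only [e]
    rw [pat_of_lt w hkN (by omega), pat_of_lt w (by omega) (by omega)]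
    simp only [Bool.xor_self]
    symm; rw [decide_eq_false_iff_not]; omega
  · by_cases h1 : k = N - 1
    · subst h1
      have e : (N - 1 + 1) % N = 0 := by rw [show N - 1 + 1 = N by omega, Nat.mod_self]
      simp only [e]
      rw [pat_last w hN, pat_of_lt w (by omega) (by omega)]
      simp only [Bool.false_xor]
      symm; rw [decide_eq_true_iff]; omega
    · have e : (k + 1) % N = k + 1 := Nat.mod_eq_of_lt (by omega)
      simp only [e]
      rw [pat_after w hkN (by omega) h1]
      by_cases h2 : k + 1 = N - 1
      · rw [pat_eq_last w hN (by omega) h2]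
        simp only [Bool.true_xor, Bool.not_false]
        symm; rw [decide_eq_true_iff]; omega
      · rw [pat_after w (by omega) (by omega) h2]
        simp only [Bool.xor_self]
        symm; rw [decide_eq_false_iff_not]; omega

/-- Every bit of the pattern is a constant or one of the parameters (positive literal). -/
theorem pat_literal (N m p : ℕ) (i : Fin N) :
    (∃ b, ∀ w, pat N m p w i = b) ∨ (∃ j, ∀ w, pat N m p w i = w j) := by
  obtain ⟨k, hk⟩ := i
  by_cases h0 : k < p
  · exact Or.inl ⟨true, fun w => by simp [pat, h0]⟩
  by_cases h1 : k < p + (6 * m + 1)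
  · -- first comb, offset r = k - p
    have key : ∀ w, pat N m p w ⟨k, hk⟩ = combBit m (ext (uPart m w)) (k - p) := fun w => by
      simp [pat, h0, h1]
    simp only [key, combBit]
    by_cases h2 : k - p ≤ 3 * m
    · simp only [if_pos h2]
      by_cases h3 : (k - p) % 3 = 0
      · simp only [if_pos h3]
        by_cases h4 : (k - p) / 3 < m
        · exact Or.inr ⟨Fin.castAdd m ⟨(k - p) / 3, h4⟩, fun w => by rw [ext_of_lt _ h4]; rfl⟩
        · exact Or.inl ⟨true, fun w => ext_of_le _ (by omega)⟩
      · exact Or.inl ⟨true, fun w => by simp [h3]⟩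
    · simp only [if_neg h2]
      by_cases h3 : (k - p - (3 * m + 1)) % 3 = 0
      · simp only [if_pos h3]
        by_cases h4 : (k - p - (3 * m + 1)) / 3 < m
        · exact Or.inr ⟨Fin.castAdd m ⟨_, h4⟩, fun w => by rw [ext_of_lt _ h4]; rfl⟩
        · exact Or.inl ⟨true, fun w => ext_of_le _ (by omega)⟩
      · exact Or.inl ⟨true, fun w => by simp [h3]⟩
  by_cases h1' : k < p + (6 * m + 1) + (6 * m + 1)
  · have key : ∀ w, pat N m p w ⟨k, hk⟩ = combBit m (ext (aPart m w)) (k - (p + (6 * m + 1))) := fun w => by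
      simp [pat, h0, h1, h1']
    simp only [key, combBit]
    by_cases h2 : k - (p + (6 * m + 1)) ≤ 3 * m
    · simp only [if_pos h2]
      by_cases h3 : (k - (p + (6 * m + 1))) % 3 = 0
      · simp only [if_pos h3]
        by_cases h4 : (k - (p + (6 * m + 1))) / 3 < m
        · exact Or.inr ⟨Fin.natAdd m ⟨_, h4⟩, fun w => by rw [ext_of_lt _ h4]; rfl⟩
        · exact Or.inl ⟨true, fun w => ext_of_le _ (by omega)⟩
      · exact Or.inl ⟨true, fun w => by simp [h3]⟩
    · simp only [if_neg h2]
      by_cases h3 : (k - (p + (6 * m + 1)) - (3 * m + 1)) % 3 = 0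
      · simp only [if_pos h3]
        by_cases h4 : (k - (p + (6 * m + 1)) - (3 * m + 1)) / 3 < m
        · exact Or.inr ⟨Fin.natAdd m ⟨_, h4⟩, fun w => by rw [ext_of_lt _ h4]; rfl⟩
        · exact Or.inl ⟨true, fun w => ext_of_le _ (by omega)⟩
      · exact Or.inl ⟨true, fun w => by simp [h3]⟩
  have hN : p + (6 * m + 1) + (6 * m + 1) + 1 ≤ N := by omega
  by_cases h5 : k = N - 1
  · exact Or.inl ⟨false, fun w => pat_eq_last w hN hk h5⟩
  · exact Or.inl ⟨true, fun w => pat_after w hk (by omega) h5⟩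

end Comb

end Summit.QuantumAdvantage.QuantumAdvantage.Theorems.RingSparseActive
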